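import Literature.Geometry.Lorentzian.CoordAdjointCutoff
import Literature.Geometry.Lorentzian.CoordEntropyFormula
import HarnessLib

/-!
# The rows of the adjoint `DΦ*` are linear in the multiplier `(N, X)`: KIDs form a vector space

The formal adjoint `DΦ*_{(G,K)}(N, X) = (DH*_γ N + DM*ˢ_γ X, DH*_κ N + DM*ˢ_κ X)` of the linearised
constraint map (`MetricCoord.adjHamG`, `adjHamK`, `adjMomGS`, `adjMomKS`,
`CoordConstraintAdjoint.lean`; Chruściel–Delay 2003, §2, the operator `P*`) is a LINEAR
differential operator in the lapse–shift multiplier `(N, X)`. This file records the corresponding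
pointwise identities (additivity and homogeneity of each row, at a point where the fields are
differentiable enough for the derivatives involved to split), and the consequence that the
solutions of the KID equations `DΦ*(N, X) = 0` at a point are closed under sums and scalar
multiples (`kid_add`, `kid_smul`, `kid_zero`): the Killing initial data of `(G, K)` on an open set
form a real vector space (Moncrief 1975, §III; Beig–Chruściel 1997). Everything is proved; no
definitions, no named facts.

* `covDAt_add`, `covDAt_const_smul` — `∇(X + Y) = ∇X + ∇Y`, `∇(cX) = c∇X`;
* `adjScalAt_add`, `adjScalAt_const_mul` — `DS*_G` is linear (`hessAt_add`, `lapAt_add`);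
* `adjHamG_add`, `adjHamG_const_mul`, `adjHamK_add`, `adjHamK_const_mul` — the `N`-rows;
* `adjMomKS_add`, `adjMomKS_const_smul`, `adjMomGS_add`, `adjMomGS_const_smul`,
  `adjMomKS_zero_field`, `adjMomGS_zero_field` — the `X`-rows;
* `kid_add`, `kid_smul`, `kid_zero` — closure of the pointwise KID equations.

## References

* P. T. Chruściel, E. Delay, Mém. Soc. Math. Fr. 94 (2003), §2. [ChruscielDelay2003]
* V. Moncrief, J. Math. Phys. 16 (1975) 493–498, §III. [Moncrief1975]
-/

noncomputable section

set_option maxSynthPendingDepth 3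

open Set Filter ContinuousLinearMap Module
open scoped Topology ContDiff

namespace Literature.Geometry.Lorentzian

namespace MetricCoord

variable {E : Type*} [NormedAddCommGroup E] [NormedSpace ℝ E] [FiniteDimensional ℝ E]
  {G K : E → E →L[ℝ] E →L[ℝ] ℝ} {x : E}

/-! ### The covariant differential of a vector field -/

omit [FiniteDimensional ℝ E] in
/-- `∇(X + Y) = ∇X + ∇Y` for fields differentiable at the point. [cite: ONeill1983, Ch. 3, Def. 3.9–3.10] -/
theorem covDAt_add {X Y : E → E} (hX : DifferentiableAt ℝ X x) (hY : DifferentiableAt ℝ Y x) :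
    covDAt G (fun y ↦ X y + Y y) x = covDAt G X x + covDAt G Y x := by
  simp only [covDAt, fderiv_fun_add hX hY, map_add]
  abel

omit [FiniteDimensional ℝ E] in
/-- `∇(c X) = c ∇X` for a constant `c`. [cite: ONeill1983, Ch. 3, Def. 3.9–3.10] -/
theorem covDAt_const_smul {X : E → E} (hX : DifferentiableAt ℝ X x) (c : ℝ) :
    covDAt G (fun y ↦ c • X y) x = c • covDAt G X x := by
  ext v
  simp only [covDAt_apply, fderiv_fun_const_smul hX, _root_.smul_apply, map_smul, smul_add]

omit [FiniteDimensional ℝ E] in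
/-- `∇0 = 0`. [folklore] -/
theorem covDAt_zero_field : covDAt G (fun _ : E ↦ (0 : E)) x = 0 := by
  ext v
  simp [covDAt_apply]

/-- `div 0 = 0` (a copy of `divAt_zero_field` of `CoordFlatKIDs.lean`, to keep the import cone
small). [folklore] -/
private theorem divAt_zero_field' : divAt G (fun _ : E ↦ (0 : E)) x = 0 := by
  rw [divAt_eq, covDAt_zero_field, map_zero]

/-! ### `DS*_G` and the `N`-rows -/

section NRows

variable {u v : E → ℝ}

/-- **`DS*_G` is additive**: `DS*_G(u + v) = DS*_G(u) + DS*_G(v)` for functions `C²` at `x`.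
[cite: ChruscielDelay2003, §2] -/
theorem adjScalAt_add (hu : ContDiffAt ℝ 2 u x) (hv : ContDiffAt ℝ 2 v x) :
    adjScalAt G (fun y ↦ u y + v y) x = adjScalAt G u x + adjScalAt G v x := by
  rw [adjScalAt, adjScalAt, adjScalAt, lapAt_add G hu hv, hessAt_add G hu hv]
  simp only [add_smul, neg_add]
  abel

/-- **`DS*_G` is homogeneous**: `DS*_G(c u) = c DS*_G(u)`. [cite: ChruscielDelay2003, §2] -/
theorem adjScalAt_const_mul (hu : ContDiffAt ℝ 2 u x) (c : ℝ) :
    adjScalAt G (fun y ↦ c * u y) x = c • adjScalAt G u x := by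
  rw [adjScalAt, adjScalAt, lapAt_const_mul G hu c, hessAt_const_mul G hu c]
  simp only [smul_sub, smul_add, smul_smul, mul_neg]

/-- **The `γ`-row of `DH*` is additive in `N`.** [cite: ChruscielDelay2003, §2] -/
theorem adjHamG_add (hu : ContDiffAt ℝ 2 u x) (hv : ContDiffAt ℝ 2 v x) :
    adjHamG G K (fun y ↦ u y + v y) x = adjHamG G K u x + adjHamG G K v x := by
  rw [adjHamG, adjHamG, adjHamG, adjScalAt_add hu hv]
  simp only [mul_add, add_mul, add_smul]
  abel

/-- **The `γ`-row of `DH*` is homogeneous in `N`.** [cite: ChruscielDelay2003, §2] -/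
theorem adjHamG_const_mul (hu : ContDiffAt ℝ 2 u x) (c : ℝ) :
    adjHamG G K (fun y ↦ c * u y) x = c • adjHamG G K u x := by
  rw [adjHamG, adjHamG, adjScalAt_const_mul hu c]
  simp only [smul_add, smul_sub, smul_smul]
  congr 1
  · congr 1
    ring_nf
  · ring_nf

omit [FiniteDimensional ℝ E] in
/-- **The `κ`-row of `DH*` is additive in `N`** (it is of order zero). [cite: ChruscielDelay2003, §2] -/
theorem adjHamK_add (u v : E → ℝ) :
    adjHamK G K (fun y ↦ u y + v y) x = adjHamK G K u x + adjHamK G K v x := by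
  rw [adjHamK, adjHamK, adjHamK]
  simp only [mul_add, add_mul, add_smul, neg_add]
  abel

omit [FiniteDimensional ℝ E] in
/-- **The `κ`-row of `DH*` is homogeneous in `N`.** [cite: ChruscielDelay2003, §2] -/
theorem adjHamK_const_mul (u : E → ℝ) (c : ℝ) :
    adjHamK G K (fun y ↦ c * u y) x = c • adjHamK G K u x := by
  rw [adjHamK, adjHamK]
  simp only [smul_add, smul_smul]
  congr 1
  · congr 1
    ring_nf
  · ring_nf

end NRows

/-! ### The `X`-rows -/

omit [FiniteDimensional ℝ E] in
/-- `sym 0 = 0`. [folklore] -/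
theorem symAt_zero : symAt (0 : E →L[ℝ] E →L[ℝ] ℝ) = 0 := by
  ext v w
  simp [symAt_apply]

/-- **The `κ`-row of `DM*ˢ` is additive in `X`.** [cite: ChruscielDelay2003, §2] -/
theorem adjMomKS_add {X Y : E → E} (hX : DifferentiableAt ℝ X x) (hY : DifferentiableAt ℝ Y x) :
    adjMomKS G (fun y ↦ X y + Y y) x = adjMomKS G X x + adjMomKS G Y x := by
  rw [adjMomKS, adjMomKS, adjMomKS, covDAt_add hX hY, divAt_add hX hY,
    ContinuousLinearMap.comp_add, symAt_add, add_smul, neg_add]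
  abel

/-- **The `κ`-row of `DM*ˢ` is homogeneous in `X`.** [cite: ChruscielDelay2003, §2] -/
theorem adjMomKS_const_smul {X : E → E} (hX : DifferentiableAt ℝ X x) (c : ℝ) :
    adjMomKS G (fun y ↦ c • X y) x = c • adjMomKS G X x := by
  have h0 : fderiv ℝ (fun _ : E ↦ c) x = 0 := fderiv_const_apply c
  rw [adjMomKS_smul (differentiableAt_const c) hX, h0]
  ext v w
  simp [symAt_apply]

/-- `DM*ˢ_κ(0) = 0`. [cite: ChruscielDelay2003, §2] -/
theorem adjMomKS_zero_field : adjMomKS G (fun _ : E ↦ (0 : E)) x = 0 := by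
  rw [adjMomKS, covDAt_zero_field, divAt_zero_field', ContinuousLinearMap.comp_zero, symAt_zero]
  simp

/-- **The `γ`-row of `DM*ˢ` is additive in `X`** (at a point where `♯K(X,·)`, `♯K(Y,·)` are
differentiable, e.g. `G`, `K`, `X`, `Y` differentiable there). [cite: ChruscielDelay2003, §2] -/
theorem adjMomGS_add {X Y : E → E} (hX : DifferentiableAt ℝ X x) (hY : DifferentiableAt ℝ Y x)
    (hKX : DifferentiableAt ℝ (fun y ↦ sharpAt G y (K y (X y))) x)
    (hKY : DifferentiableAt ℝ (fun y ↦ sharpAt G y (K y (Y y))) x) :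
    adjMomGS G K (fun y ↦ X y + Y y) x = adjMomGS G K X x + adjMomGS G K Y x := by
  have hfun : (fun y ↦ sharpAt G y (K y (X y + Y y))) =
      fun y ↦ sharpAt G y (K y (X y)) + sharpAt G y (K y (Y y)) := by
    funext y
    rw [map_add, map_add]
  rw [adjMomGS, adjMomGS, adjMomGS, covDAt_add hX hY, divAt_add hX hY, hfun, divAt_add hKX hKY,
    ContinuousLinearMap.comp_add, symAt_add, map_add]
  simp only [mul_add, add_smul, smul_add]
  abel

/-- **The `γ`-row of `DM*ˢ` is homogeneous in `X`.** [cite: ChruscielDelay2003, §2] -/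
theorem adjMomGS_const_smul {X : E → E} (hX : DifferentiableAt ℝ X x)
    (hKX : DifferentiableAt ℝ (fun y ↦ sharpAt G y (K y (X y))) x) (c : ℝ) :
    adjMomGS G K (fun y ↦ c • X y) x = c • adjMomGS G K X x := by
  have h0 : fderiv ℝ (fun _ : E ↦ c) x = 0 := fderiv_const_apply c
  rw [adjMomGS_smul (differentiableAt_const c) hX hKX, h0]
  ext v w
  simp [symAt_apply]

/-- `DM*ˢ_γ(0) = 0`. [cite: ChruscielDelay2003, §2] -/
theorem adjMomGS_zero_field : adjMomGS G K (fun _ : E ↦ (0 : E)) x = 0 := by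
  have hfun : (fun y ↦ sharpAt G y (K y ((fun _ : E ↦ (0 : E)) y))) = fun _ ↦ (0 : E) := by
    funext y
    simp
  rw [adjMomGS, covDAt_zero_field, hfun, divAt_zero_field', ContinuousLinearMap.comp_zero,
    symAt_zero, map_zero]
  simp

/-! ### KIDs form a vector space -/

section KID

/-- **Sums of KIDs are KIDs** (pointwise form): if `(u, X)` and `(v, Y)` both solve the two KID
equations `DH*_γ N + DM*ˢ_γ X = 0`, `DH*_κ N + DM*ˢ_κ X = 0` at `x` (`u`, `v` of class `C²` at `x`,
`X`, `Y`, `♯K(X,·)`, `♯K(Y,·)` differentiable at `x`), then so does `(u + v, X + Y)`.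
Moncrief 1975, §III (the KIDs form a vector space). [cite: Moncrief1975, §III] -/
theorem kid_add {u v : E → ℝ} {X Y : E → E} (hu : ContDiffAt ℝ 2 u x) (hv : ContDiffAt ℝ 2 v x)
    (hX : DifferentiableAt ℝ X x) (hY : DifferentiableAt ℝ Y x)
    (hKX : DifferentiableAt ℝ (fun y ↦ sharpAt G y (K y (X y))) x)
    (hKY : DifferentiableAt ℝ (fun y ↦ sharpAt G y (K y (Y y))) x)
    (h₁ : adjHamG G K u x + adjMomGS G K X x = 0 ∧ adjHamK G K u x + adjMomKS G X x = 0)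
    (h₂ : adjHamG G K v x + adjMomGS G K Y x = 0 ∧ adjHamK G K v x + adjMomKS G Y x = 0) :
    adjHamG G K (fun y ↦ u y + v y) x + adjMomGS G K (fun y ↦ X y + Y y) x = 0 ∧
      adjHamK G K (fun y ↦ u y + v y) x + adjMomKS G (fun y ↦ X y + Y y) x = 0 := by
  rw [adjHamG_add hu hv, adjMomGS_add hX hY hKX hKY, adjHamK_add, adjMomKS_add hX hY]
  constructor
  · calc adjHamG G K u x + adjHamG G K v x + (adjMomGS G K X x + adjMomGS G K Y x)
        = (adjHamG G K u x + adjMomGS G K X x) + (adjHamG G K v x + adjMomGS G K Y x) := by abel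
      _ = 0 := by rw [h₁.1, h₂.1, add_zero]
  · calc adjHamK G K u x + adjHamK G K v x + (adjMomKS G X x + adjMomKS G Y x)
        = (adjHamK G K u x + adjMomKS G X x) + (adjHamK G K v x + adjMomKS G Y x) := by abel
      _ = 0 := by rw [h₁.2, h₂.2, add_zero]

/-- **Scalar multiples of KIDs are KIDs** (pointwise form). [cite: Moncrief1975, §III] -/
theorem kid_smul {u : E → ℝ} {X : E → E} (hu : ContDiffAt ℝ 2 u x) (hX : DifferentiableAt ℝ X x)
    (hKX : DifferentiableAt ℝ (fun y ↦ sharpAt G y (K y (X y))) x) (c : ℝ)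
    (h₁ : adjHamG G K u x + adjMomGS G K X x = 0 ∧ adjHamK G K u x + adjMomKS G X x = 0) :
    adjHamG G K (fun y ↦ c * u y) x + adjMomGS G K (fun y ↦ c • X y) x = 0 ∧
      adjHamK G K (fun y ↦ c * u y) x + adjMomKS G (fun y ↦ c • X y) x = 0 := by
  rw [adjHamG_const_mul hu c, adjMomGS_const_smul hX hKX c, adjHamK_const_mul, adjMomKS_const_smul hX c,
    ← smul_add, ← smul_add, h₁.1, h₁.2, smul_zero]
  exact ⟨rfl, rfl⟩

/-- **The zero pair is a KID.** [cite: Moncrief1975, §III] -/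
theorem kid_zero :
    adjHamG G K (fun _ : E ↦ (0 : ℝ)) x + adjMomGS G K (fun _ : E ↦ (0 : E)) x = 0 ∧
      adjHamK G K (fun _ : E ↦ (0 : ℝ)) x + adjMomKS G (fun _ : E ↦ (0 : E)) x = 0 := by
  rw [adjHamG_zero, adjMomGS_zero_field, adjHamK_zero, adjMomKS_zero_field, add_zero]
  exact ⟨rfl, rfl⟩

end KID

end MetricCoord

end Literature.Geometry.Lorentzian

end
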